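import Literature.MathematicalPhysics.QuantumFieldTheory.Balaban1983to89.B9BlockL2ReblockEngine
import Literature.MathematicalPhysics.QuantumFieldTheory.Balaban1983to89.B9Ineq369CurvatureSmallAtLettersY
import Literature.MathematicalPhysics.QuantumFieldTheory.Balaban1983to89.Node00.OpsYSectDCoords

/-!
# `Balaban1983to89.B9Eq346GradGpDivCoordsL2` — T. Bałaban, *Propagators for lattice gauge theories in a background field*, Commun. Math. Phys. **99**
# (1985) 389–434 [Balaban1985BackgroundPropagators] (3.46) p. 398 with [4] (2.51)–(2.54) pp. 232–233, Lemma 2.1 (2.61) p. 234: THE BLOCK-`L²` DICTIONARY FOR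
# `M_N(ℂ)`-VALUED LETTERS IN dag-n06-d's TRACE-BASIS COORDINATES — (i) an HS block-to-block bound of an ℝ-linear `T` on matrix-valued fields IS a `BlockBd` of the mixed
# coordinate model `coordOpKH (trBasis N) (fun _ => T)` w.r.t. the torus block map pulled back along `Prod.fst` (Parseval); (ii) dag-n06-w3's `L²` RE-BLOCKING ENGINE
# (torus blocks `blkV1` → the certificate's index-bond block map `bI`) on ANY finite carrier pulled back along `π : X → FBondY i`

statement-level skeleton of published theorems with citation tags; proofs where landed; nothing here is a claim about the Yang–Mills mass gap

THE PRINT.  [B9] (3.46) p. 398, p. 393 (`X·Y = tr XY`), p. 397 (`𝔅`, `d(y,y′)` of [4] (2.46)); [4] (2.51)–(2.54) pp. 232–233, (2.45)–(2.46) p. 231, Lemma 2.1 (2.61) p. 234.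
WHY THIS FILE (cell context; WIDTH-209 N06 piece 4 = W-e «`hstepL2` in block-L²», this seat's located INPUT HAND (3.46)₄, agreed with the piece's holder dag-n06-w8 on the
pub-ymgap bus 2026-08-28).  The sequel `B9Eq346GradGpDivAtPinsL2` reads the prequel's PROVED torus estimate (`B9Eq346GradGpDivTorusL2.hs_block_gradY_GpY_divY_le`: HS block
sums of `D_U G′(U) D\*_U` between torus blocks of fine bonds) as the certificate's `BlockBd` of the coordinate letter `DvcoKH ∘ GcoS(G′) ∘ DvscoKH` over `blkBK bI`.  Two
pieces of dictionary are needed and are typed HERE, letter-free: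
* §1 PARSEVAL IN THE TRACE BASIS — `sum_sq_repr_trBasis` (`Σ_c (repr_c v)² = Σ_{ab}‖v_{ab}‖²`, from `B9CoReadingCoordsTranspose.trBasis_repr_eq_trace`; the two-vector form is
  dag-n06-i's `B9Eq3132CoerciveVariational.sum_repr_mul_repr`, re-derived on the diagonal to keep the import closure small), the slice-wise squared block sizes
  `bsq_fst_eq_sum_slices ∕ sum_bsq_slices_eq_hs ∕ sum_bsq_slices_coordOpKH_eq_hs`, and ★ `blockBd_fst_coordOpKH_of_hs`: if `Σ_{z∈Δ(y)} HS((TΛ)(z)) ≤ K(y,y′)²·Σ_z HS(Λ(z))`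
  for every `Λ` vanishing off `Δ(y′)`, then `BlockBd (blk′ ∘ fst) (blk ∘ fst) (coordOpKH (trBasis N) (fun _ => T)) K` (the `(ν, c′)`-slices of the carrier decouple).
* §2 THE RE-BLOCKING ENGINE ON A PULLED-BACK CARRIER — dag-n06-w3's `B9BlockL2ReblockEngine` is typed for REAL operators on `FBondY i → ℝ`; at curved `U` a matrix-valued
  letter does not factor through one, so the engine is re-run (same proofs, cited) with the block maps `blkV1 ∘ π`, `bI ∘ π` on any finite `X`:
  `blockPiece_pull_eq_zero_of_far`, `bl2_pull_apply_le_of_near` ((2.52) summed by (2.61) at a quarter of the rate), `bsq_pull_bI_le_sum_near` (`hβ1`),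
  `bsq_blockPiece_pull_bI_le` (`hlev`), `sqrt_sum_sq_eq_bl2_of_supp`, ★ `blockBd_pull_bI_of_blockBd_torus`: kernel `C·e^{−δd_T}` at (`geomT i.D`, `blkV1 ∘ π`) ⇒
  kernel `C·c·e^{(3∕2)δ}·√(e^{δ∕4}c)·e^{−¾δ·d(a,a′)}` at (`toB6 (geo9K i) R₀ H₀`, `bI ∘ π`) for a LEVEL- and 1-FAITHFUL `bI` (its counting lemma `card_near_le` cited by name).
HONEST SCOPE.  Finite sums, Parseval and [4] (2.52)–(2.54)∕(2.61) bookkeeping over landed modules; no estimate of [B9] asserted; count-neutral; N06 NOT discharged; one finite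
lattice at a time — nothing continuum ∕ OS ∕ mass gap ∕ Clay.  Cell `pub-ymgap` (HUMAN RULING D-0062 ∕ D-0154), Track A node N06 [B9], width seat `pub-ymgap-dag-n06-w7` (g0),
2026-08-28.  NEW file; nothing landed is modified.  Net new unproved facts: 0.
-/

noncomputable section

namespace Literature.MathematicalPhysics.QuantumFieldTheory.Balaban1983to89.B9Eq346GradGpDivCoordsL2

open Literature.MathematicalPhysics.QuantumFieldTheory.Balaban1983to89
open Node00 B6KLevelCensusIndexV1 B6Geom246MultiLevelBox B6MultiLevelTorusOperator B6GlobalChartV1 B6Geom246MultiLevelTorus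
open Literature.MathematicalPhysics.QuantumFieldTheory.Balaban1983to89.B6RandomWalk (blockPiece sum_blockPiece)
open Literature.MathematicalPhysics.QuantumFieldTheory.Balaban1983to89.B6Ineq2142KLevelV1 (lvl β)
open Literature.MathematicalPhysics.QuantumFieldTheory.Balaban1983to89.B6Ineq288MultiLevelTorus (dist_symm_geoBT)
open Literature.MathematicalPhysics.QuantumFieldTheory.Balaban1983to89.B6Lemma21Repaired (Ineq261With)
open Literature.MathematicalPhysics.QuantumFieldTheory.Balaban1983to89.B9GeoNormsKLevelV1 (geo9K)
open Literature.MathematicalPhysics.QuantumFieldTheory.Balaban1983to89.B9Ineq349SiteComposite (distB distB_nonneg)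
open Literature.MathematicalPhysics.QuantumFieldTheory.Balaban1983to89.B9Ineq349SiteFromBlocks (distB_triangle)
open Literature.MathematicalPhysics.QuantumFieldTheory.Balaban1983to89.B9CoReadingCoords (assembleK coordOpK XBK blkBK)
open Literature.MathematicalPhysics.QuantumFieldTheory.Balaban1983to89.B9CoReadingCoordsH (coordOpKH coordOpKH_apply)
open Literature.MathematicalPhysics.QuantumFieldTheory.Balaban1983to89.B9CoReadingCoordsTranspose (TrIdx trBasis trBasis_repr_eq_trace)
open Literature.MathematicalPhysics.QuantumFieldTheory.Balaban1983to89.B9Thm34Ext (toB6)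
open Literature.MathematicalPhysics.QuantumFieldTheory.Balaban1983to89.B9SectDL2Decay (bsq bl2 BlockBd bsq_nonneg bl2_nonneg bl2_sq sum_bsq)
open Literature.MathematicalPhysics.QuantumFieldTheory.Balaban1983to89.B9BlockL2ReblockEngine (bl2_sum_le bl2_le_l2n card_near_le)
open Literature.MathematicalPhysics.QuantumFieldTheory.Balaban1983to89.B9Ineq369CurvatureSmallAtLettersY (hs_nonneg hs_eq_re_trace)
open Literature.MathematicalPhysics.QuantumFieldTheory.Balaban1983to89.Node00.OpsYSectDCoords (repr_assembleK)
open scoped Matrix Matrix.Norms.L2Operator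

variable {d ℓ : ℕ} {hd : 1 ≤ d + 1} {hL : Odd (ℓ + 1) ∧ 1 < ℓ + 1} {b₀ b₁ : ℝ}

/-! ## §1 Parseval in the trace basis; the slice-wise block sizes of the mixed coordinate model; HS bound ⇒ `BlockBd` -/

section Parseval

variable {N : ℕ}

/-- **PARSEVAL IN THE TRACE BASIS**: `Σ_c (repr_c v)² = Σ_{a,b} ‖v_{ab}‖²` (`trBasis N` is orthonormal for `Re tr(X\*Y)`; the two-vector form is dag-n06-i's
`B9Eq3132CoerciveVariational.sum_repr_mul_repr`, re-derived here on the diagonal to keep the import closure small). [cite: Balaban1985BackgroundPropagators, p.393 (scalar products), bookkeeping] -/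
theorem sum_sq_repr_trBasis (v : Matrix (Fin N) (Fin N) ℂ) : ∑ c : TrIdx N, ((trBasis N).repr v c) ^ 2 = ∑ a, ∑ b, ‖v a b‖ ^ 2 := by
  -- adapted from `B9Eq3132CoerciveVariational.sum_repr_mul_repr` (dag-n06-i)
  have h1 : ∀ c, (trBasis N).repr v c * (trBasis N).repr v c = (Matrix.trace (((trBasis N).repr v c • trBasis N c)ᴴ * v)).re := by
    intro c
    rw [trBasis_repr_eq_trace N v c, Matrix.conjTranspose_smul, star_trivial, Matrix.smul_mul, Matrix.trace_smul, Complex.smul_re, smul_eq_mul,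
      ← trBasis_repr_eq_trace N v c]
  rw [Finset.sum_congr rfl fun c _ => (pow_two _).trans (h1 c), ← Complex.re_sum, ← Matrix.trace_sum, ← Finset.sum_mul, ← Matrix.conjTranspose_sum,
    (trBasis N).sum_repr v, hs_eq_re_trace]

variable {G : B6.Geometry} {S S' D : Type} [Fintype S] [Fintype S'] [Fintype D]

/-- the squared block size for a block map pulled back along `Prod.fst` is the sum over the slices `(ν, c, c′)`. [cite: Balaban1984PropagatorsII, (2.54) p.233, bookkeeping] -/
theorem bsq_fst_eq_sum_slices {κ : Type} [Fintype κ] (blk : S' → G.Site) (y : G.Site) (μ : S' × D × κ × κ → ℝ) :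
    bsq (g := G) (fun p : S' × D × κ × κ => blk p.1) y μ = ∑ ν : D, ∑ c : κ, ∑ c' : κ, bsq (g := G) blk y (fun z => μ (z, ν, c, c')) := by
  -- adapted from dag-n06-w3's `B9Letters313AtOneL2.bsq_slicewise`
  classical
  simp only [bsq, Fintype.sum_prod_type]
  rw [Finset.sum_comm]
  refine Finset.sum_congr rfl fun ν _ => ?_
  rw [Finset.sum_comm]
  refine Finset.sum_congr rfl fun c _ => ?_
  rw [Finset.sum_comm]

omit [Fintype D] in
open Classical in
/-- the `c`-summed squared block size of the `(ν, c′)`-slices of a carrier vector is the block HS-sum of the re-assembled `M_N(ℂ)`-valued field.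
[cite: Balaban1985BackgroundPropagators, p.393 (scalar products); Balaban1984PropagatorsII, (2.54) p.233, bookkeeping] -/
theorem sum_bsq_slices_eq_hs (blk : S' → G.Site) (y : G.Site) (μ : S' × D × TrIdx N × TrIdx N → ℝ) (ν : D) (c' : TrIdx N) :
    ∑ c : TrIdx N, bsq (g := G) blk y (fun z => μ (z, ν, c, c')) =
      ∑ z : S', (if blk z = y then (∑ a, ∑ b, ‖assembleK (trBasis N) ν c' μ z a b‖ ^ 2) else 0) := by
  classical
  simp only [bsq]
  rw [Finset.sum_comm]
  refine Finset.sum_congr rfl fun z _ => ?_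
  split_ifs with h
  · rw [← sum_sq_repr_trBasis]
    exact Finset.sum_congr rfl fun c _ => by rw [repr_assembleK]
  · simp

omit [Fintype S'] [Fintype D] in
open Classical in
/-- the `c`-summed squared block size of the `(ν, c′)`-slices of `coordOpKH (trBasis N) (fun _ => T) μ` is the block HS-sum of `T` applied to the re-assembled slice.
[cite: Balaban1985BackgroundPropagators, (3.46) p.398; Balaban1984PropagatorsII, (2.54) p.233, bookkeeping] -/
theorem sum_bsq_slices_coordOpKH_eq_hs (blk : S → G.Site) (y : G.Site) (T : (S' → Matrix (Fin N) (Fin N) ℂ) →ₗ[ℝ] (S → Matrix (Fin N) (Fin N) ℂ))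
    (μ : S' × D × TrIdx N × TrIdx N → ℝ) (ν : D) (c' : TrIdx N) :
    ∑ c : TrIdx N, bsq (g := G) blk y (fun z => coordOpKH (trBasis N) (fun _ : D => T) μ (z, ν, c, c')) =
      ∑ z : S, (if blk z = y then (∑ a, ∑ b, ‖T (assembleK (trBasis N) ν c' μ) z a b‖ ^ 2) else 0) := by
  classical
  simp only [bsq, coordOpKH_apply]
  rw [Finset.sum_comm]
  refine Finset.sum_congr rfl fun z _ => ?_
  split_ifs with h
  · exact sum_sq_repr_trBasis _
  · simp

open Classical in
/-- ★ **AN HS BLOCK-TO-BLOCK BOUND IS A `BlockBd` OF THE MIXED COORDINATE MODEL** (trace basis, slice-wise torus block maps, the SAME kernel `K ≥ 0`): if for every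
`M_N(ℂ)`-valued field `Λ` vanishing off the block `y′` and every block `y`, `Σ_{z∈Δ(y)} HS((TΛ)(z)) ≤ K(y,y′)²·Σ_z HS(Λ(z))`, then
`BlockBd (blk′ ∘ fst) (blk ∘ fst) (coordOpKH (trBasis N) (fun _ => T)) K`. [cite: Balaban1985BackgroundPropagators, (3.46) p.398; Balaban1984PropagatorsII, (2.51)–(2.54) pp.232–233] -/
theorem blockBd_fst_coordOpKH_of_hs {blk' : S' → G.Site} {blk : S → G.Site} {T : (S' → Matrix (Fin N) (Fin N) ℂ) →ₗ[ℝ] (S → Matrix (Fin N) (Fin N) ℂ)}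
    {K : G.Site → G.Site → ℝ} (hK : ∀ y y', 0 ≤ K y y')
    (hT : ∀ (Λ : S' → Matrix (Fin N) (Fin N) ℂ) (y y' : G.Site), (∀ z, blk' z ≠ y' → Λ z = 0) →
      ∑ z : S, (if blk z = y then (∑ a, ∑ b, ‖T Λ z a b‖ ^ 2) else 0) ≤ K y y' ^ 2 * ∑ z : S', ∑ a, ∑ b, ‖Λ z a b‖ ^ 2) :
    BlockBd (g := G) (fun p : S' × D × TrIdx N × TrIdx N => blk' p.1) (fun p : S × D × TrIdx N × TrIdx N => blk p.1)
      (coordOpKH (trBasis N) (fun _ : D => T)) K := by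
  classical
  intro y' μ hμ y
  -- the re-assembled slices vanish off `y′`
  have hΛ : ∀ (ν : D) (c' : TrIdx N) (z : S'), blk' z ≠ y' → assembleK (trBasis N) ν c' μ z = 0 := by
    intro ν c' z hz
    have hrepr : ∀ c, (trBasis N).repr (assembleK (trBasis N) ν c' μ z) c = 0 := fun c => by
      rw [repr_assembleK]; exact hμ (z, ν, c, c') hz
    have h := (trBasis N).sum_repr (assembleK (trBasis N) ν c' μ z)
    rw [← h]
    exact Finset.sum_eq_zero fun c _ => by rw [hrepr c, zero_smul]
  -- the source size: `Σ_{ν,c′} Σ_z HS(Λ_{ν c′}(z))` (all of `z`, the slices vanish off `y′`)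
  have hsrc : bsq (g := G) (fun p : S' × D × TrIdx N × TrIdx N => blk' p.1) y' μ
      = ∑ ν : D, ∑ c' : TrIdx N, ∑ z : S', ∑ a, ∑ b, ‖assembleK (trBasis N) ν c' μ z a b‖ ^ 2 := by
    rw [bsq_fst_eq_sum_slices]
    refine Finset.sum_congr rfl fun ν _ => ?_
    rw [Finset.sum_comm]
    refine Finset.sum_congr rfl fun c' _ => ?_
    rw [sum_bsq_slices_eq_hs]
    refine Finset.sum_congr rfl fun z _ => ?_
    split_ifs with h
    · rfl
    · rw [hΛ ν c' z h]; simp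
  -- the target size, slice by slice
  have htgt : bsq (g := G) (fun p : S × D × TrIdx N × TrIdx N => blk p.1) y (coordOpKH (trBasis N) (fun _ : D => T) μ)
      = ∑ ν : D, ∑ c' : TrIdx N, ∑ z : S, (if blk z = y then (∑ a, ∑ b, ‖T (assembleK (trBasis N) ν c' μ) z a b‖ ^ 2) else 0) := by
    rw [bsq_fst_eq_sum_slices]
    refine Finset.sum_congr rfl fun ν _ => ?_
    rw [Finset.sum_comm]
    exact Finset.sum_congr rfl fun c' _ => sum_bsq_slices_coordOpKH_eq_hs blk y T μ ν c'
  have hsq : bsq (g := G) (fun p : S × D × TrIdx N × TrIdx N => blk p.1) y (coordOpKH (trBasis N) (fun _ : D => T) μ)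
      ≤ K y y' ^ 2 * bsq (g := G) (fun p : S' × D × TrIdx N × TrIdx N => blk' p.1) y' μ := by
    rw [htgt, hsrc, Finset.mul_sum]
    refine Finset.sum_le_sum fun ν _ => ?_
    rw [Finset.mul_sum]
    exact Finset.sum_le_sum fun c' _ => hT _ y y' (hΛ ν c')
  unfold bl2
  calc Real.sqrt (bsq (g := G) (fun p : S × D × TrIdx N × TrIdx N => blk p.1) y (coordOpKH (trBasis N) (fun _ : D => T) μ))
      ≤ Real.sqrt (K y y' ^ 2 * bsq (g := G) (fun p : S' × D × TrIdx N × TrIdx N => blk' p.1) y' μ) := Real.sqrt_le_sqrt hsq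
    _ = K y y' * Real.sqrt (bsq (g := G) (fun p : S' × D × TrIdx N × TrIdx N => blk' p.1) y' μ) := by
        rw [Real.sqrt_mul (sq_nonneg _), Real.sqrt_sq (hK y y')]

end Parseval

/-! ## §2 The L² re-blocking engine on a carrier pulled back along `π : X → FBondY i` (adapted from dag-n06-w3's `B9BlockL2ReblockEngine`) -/

section Reblock

variable (i : KIdx d ℓ hd hL b₀ b₁) {X : Type} [Fintype X] (π : X → FBondY i)

omit [Fintype X] in
/-- the torus-block piece of a carrier vector vanishing off the blocks within `r` of `y₀` is zero on any farther block (pull-back form of dag-n06-w3's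
`blockPiece_eq_zero_of_far`). [cite: Balaban1984PropagatorsII, (2.52) p.232, bookkeeping] -/
theorem blockPiece_pull_eq_zero_of_far {y₀ B : BlkY i} {r : ℝ} {v : X → ℝ}
    (hsupp : ∀ x, v x ≠ 0 → distB i y₀ (blkV1 i.hN i.D (π x)) ≤ r) (hB : ¬ distB i y₀ B ≤ r) :
    blockPiece (g := geomT i.D) (fun x => blkV1 i.hN i.D (π x)) B v = 0 := by
  funext x; unfold blockPiece; split_ifs with hx
  · by_contra hvx; exact hB (hx ▸ hsupp x hvx)
  · rfl

/-- ★ a block-L²-bounded operator on a source spread near one torus block, pull-back carrier (dag-n06-w3's `bl2_apply_le_of_near`, kernel `C·e^{−δd_T}`):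
`‖1_{Δ(y)}Tv‖ ≤ C·c·e^{¾δr}·e^{−¾δ·d_T(y,y₀)}·‖v‖`. [cite: Balaban1984PropagatorsII, (2.51)–(2.54) pp.232–233, Lemma 2.1 (2.61) p.234] -/
theorem bl2_pull_apply_le_of_near {T : Module.End ℝ (X → ℝ)} {C δ : ℝ} (hC : 0 ≤ C) (hδ : 0 ≤ δ)
    (hT : BlockBd (g := geomT i.D) (fun x => blkV1 i.hN i.D (π x)) (fun x => blkV1 i.hN i.D (π x)) T
      (fun y y' => C * Real.exp (-(δ * (geomT i.D).dist y y'))))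
    {c : ℝ} (h261 : Ineq261With c (geomT i.D) δ (1 / 4)) (y₀ : BlkY i) {r : ℝ}
    (v : X → ℝ) (hsupp : ∀ x, v x ≠ 0 → distB i y₀ (blkV1 i.hN i.D (π x)) ≤ r) (y : BlkY i) :
    bl2 (g := geomT i.D) (fun x => blkV1 i.hN i.D (π x)) y (T v) ≤
      C * c * Real.exp (3 / 4 * δ * r) * Real.exp (-(3 / 4 * δ * distB i y y₀)) * Real.sqrt (∑ x, v x ^ 2) := by
  -- adapted from `B9BlockL2ReblockEngine.bl2_apply_le_of_near` (dag-n06-w3), `m = 0`, block map `blkV1 ∘ π`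
  classical
  set blk : X → BlkY i := fun x => blkV1 i.hN i.D (π x) with hblk
  have hv : v = ∑ B, blockPiece (g := geomT i.D) blk B v := (sum_blockPiece (g := geomT i.D) blk v).symm
  have hT' : T v = ∑ B, T (blockPiece (g := geomT i.D) blk B v) := by
    conv_lhs => rw [hv]
    rw [map_sum]
  set nv : ℝ := Real.sqrt (∑ x, v x ^ 2) with hnv
  have hnv0 : 0 ≤ nv := Real.sqrt_nonneg _
  have hterm : ∀ B : BlkY i, bl2 (g := geomT i.D) blk y (T (blockPiece (g := geomT i.D) blk B v)) ≤
      C * nv * Real.exp (3 / 4 * δ * r) * Real.exp (-(3 / 4 * δ * distB i y y₀)) * Real.exp (-(1 / 4 * δ * distB i y B)) := by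
    intro B
    by_cases hB : distB i y₀ B ≤ r
    · have hpc : ∀ x, blk x ≠ B → blockPiece (g := geomT i.D) blk B v x = 0 := fun x hx => by
        unfold blockPiece; split_ifs with h'; exacts [absurd h' hx, rfl]
      have h1 := hT B _ hpc y
      rw [B9SectDL2Decay.bl2_blockPiece_self] at h1
      have h2 : bl2 (g := geomT i.D) blk B v ≤ nv := bl2_le_l2n _ _ _
      have htri : distB i y y₀ ≤ distB i y B + r := by
        have t := distB_triangle i y B y₀
        have hs : distB i B y₀ = distB i y₀ B := dist_symm_geoBT (toKT i) _ _
        linarith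
      have hexp : Real.exp (-(δ * (geomT i.D).dist y B)) ≤
          Real.exp (3 / 4 * δ * r) * Real.exp (-(3 / 4 * δ * distB i y y₀)) * Real.exp (-(1 / 4 * δ * distB i y B)) := by
        rw [← Real.exp_add, ← Real.exp_add]
        refine Real.exp_le_exp.2 ?_
        change -(δ * distB i y B) ≤ _
        have h34 : 3 / 4 * δ * distB i y y₀ ≤ 3 / 4 * δ * (distB i y B + r) := mul_le_mul_of_nonneg_left htri (by positivity)
        linarith
      calc bl2 (g := geomT i.D) blk y (T (blockPiece (g := geomT i.D) blk B v))
          ≤ C * Real.exp (-(δ * (geomT i.D).dist y B)) * bl2 (g := geomT i.D) blk B v := h1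
        _ ≤ C * (Real.exp (3 / 4 * δ * r) * Real.exp (-(3 / 4 * δ * distB i y y₀)) * Real.exp (-(1 / 4 * δ * distB i y B))) * nv :=
            mul_le_mul (mul_le_mul_of_nonneg_left hexp hC) h2 (bl2_nonneg _ _ _) (by positivity)
        _ = _ := by ring
    · rw [blockPiece_pull_eq_zero_of_far i π hsupp hB, map_zero]
      have h0 : bl2 (g := geomT i.D) blk y (0 : X → ℝ) = 0 := by unfold bl2 bsq; simp
      rw [h0]
      positivity
  have h261' : ∑ B : BlkY i, Real.exp (-(1 / 4 * δ * distB i y B)) ≤ c := h261 y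
  calc bl2 (g := geomT i.D) blk y (T v)
      = bl2 (g := geomT i.D) blk y (∑ B, T (blockPiece (g := geomT i.D) blk B v)) := by rw [hT']
    _ ≤ ∑ B, bl2 (g := geomT i.D) blk y (T (blockPiece (g := geomT i.D) blk B v)) := bl2_sum_le _ _ _ _
    _ ≤ ∑ B : BlkY i, C * nv * Real.exp (3 / 4 * δ * r) * Real.exp (-(3 / 4 * δ * distB i y y₀)) * Real.exp (-(1 / 4 * δ * distB i y B)) :=
        Finset.sum_le_sum fun B _ => hterm B
    _ = C * nv * Real.exp (3 / 4 * δ * r) * Real.exp (-(3 / 4 * δ * distB i y y₀)) * ∑ B : BlkY i, Real.exp (-(1 / 4 * δ * distB i y B)) := by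
        rw [Finset.mul_sum]
    _ ≤ C * nv * Real.exp (3 / 4 * δ * r) * Real.exp (-(3 / 4 * δ * distB i y y₀)) * c := mul_le_mul_of_nonneg_left h261' (by positivity)
    _ = _ := by ring

/-- the squared block-L² size over the `bI ∘ π`-fibre of an index bond `a` is at most the sum of the squared torus-block sizes of the fibre piece over the blocks within
distance 1 of the carrier block of `a` (`hβ1`; pull-back form of dag-n06-w3's `bsq_bI_le_sum_near`). [cite: Balaban1984PropagatorsII, (2.45)–(2.46) p.231, (2.52) p.232, bookkeeping] -/
theorem bsq_pull_bI_le_sum_near {bI : FBondY i → IBondY i}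
    (hβ1 : ∀ f : FBondY i, (geomT i.D).dist (β i.hN i.D i.hk (bI f)) (blkV1 i.hN i.D f) ≤ 1) [Fintype (geo9K i).Site]
    (R₀ : ℝ) (H₀ : Prop) (a : IBondY i) (F : X → ℝ) :
    bsq (g := toB6 (geo9K i) R₀ H₀) (fun x => bI (π x)) a F ≤
      ∑ B ∈ Finset.univ.filter (fun B : BlkY i => distB i (β i.hN i.D i.hk a) B ≤ 1),
        bsq (g := geomT i.D) (fun x => blkV1 i.hN i.D (π x)) B (blockPiece (g := toB6 (geo9K i) R₀ H₀) (fun x => bI (π x)) a F) := by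
  -- adapted from `B9BlockL2ReblockEngine.bsq_bI_le_sum_near` (dag-n06-w3)
  classical
  set Fa := blockPiece (g := toB6 (geo9K i) R₀ H₀) (fun x => bI (π x)) a F with hFa
  have h1 : bsq (g := toB6 (geo9K i) R₀ H₀) (fun x => bI (π x)) a F = ∑ x, Fa x ^ 2 := by
    unfold bsq
    refine Finset.sum_congr rfl fun x _ => ?_
    rw [hFa]; unfold blockPiece; split_ifs <;> ring
  have h2 : ∑ x, Fa x ^ 2 = ∑ B, bsq (g := geomT i.D) (fun x => blkV1 i.hN i.D (π x)) B Fa := (sum_bsq _ Fa).symm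
  have h3 : ∀ B ∈ (Finset.univ : Finset (BlkY i)), B ∉ Finset.univ.filter (fun B : BlkY i => distB i (β i.hN i.D i.hk a) B ≤ 1) →
      bsq (g := geomT i.D) (fun x => blkV1 i.hN i.D (π x)) B Fa = 0 := fun B _ hB => by
    unfold bsq
    refine Finset.sum_eq_zero fun x _ => ?_
    split_ifs with hxB
    · rw [hFa]
      unfold blockPiece
      split_ifs with hxa
      · exfalso
        apply hB
        rw [Finset.mem_filter]
        refine ⟨Finset.mem_univ _, ?_⟩
        have hxa' : bI (π x) = a := hxa
        have hxB' : blkV1 i.hN i.D (π x) = B := hxB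
        have := hβ1 (π x)
        rw [hxa', hxB'] at this
        exact this
      · ring
    · rfl
  rw [h1, h2]
  exact le_of_eq (Finset.sum_subset (Finset.filter_subset _ _) h3).symm

/-- the fibre piece of `F` over the index bond `a` vanishes on every torus block whose level is not `j(a)` (`hlev`), and its torus-block size is at most that of `F`
(pull-back form of dag-n06-w3's `bsq_blockPiece_bI_le`). [cite: Balaban1984PropagatorsII, (2.45) p.231, (2.52) p.232, bookkeeping] -/
theorem bsq_blockPiece_pull_bI_le {bI : FBondY i → IBondY i} (hlev : ∀ f : FBondY i, lvl i.hN i.D i.hk (bI f) = (blkV1 i.hN i.D f).1.1)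
    [Fintype (geo9K i).Site] (R₀ : ℝ) (H₀ : Prop) (a : IBondY i) (F : X → ℝ) (B : BlkY i) :
    bsq (g := geomT i.D) (fun x => blkV1 i.hN i.D (π x)) B (blockPiece (g := toB6 (geo9K i) R₀ H₀) (fun x => bI (π x)) a F) ≤
      (if B.1.1 = lvl i.hN i.D i.hk a then bsq (g := geomT i.D) (fun x => blkV1 i.hN i.D (π x)) B F else 0) := by
  -- adapted from `B9BlockL2ReblockEngine.bsq_blockPiece_bI_le` (dag-n06-w3)
  classical
  unfold bsq
  split_ifs with hB
  · refine Finset.sum_le_sum fun x _ => ?_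
    split_ifs with hxB
    · unfold blockPiece
      split_ifs
      · exact le_rfl
      · rw [zero_pow two_ne_zero]; positivity
    · exact le_rfl
  · refine le_of_eq (Finset.sum_eq_zero fun x _ => ?_)
    split_ifs with hxB
    · unfold blockPiece
      split_ifs with hxa
      · have hxa' : bI (π x) = a := hxa
        have hxB' : blkV1 i.hN i.D (π x) = B := hxB
        exfalso; apply hB; rw [← hxB', ← hlev (π x), hxa']
      · ring
    · rfl

/-- the flat `L²` norm of a vector vanishing off one fibre of a block map is its block size there. [cite: Balaban1984PropagatorsII, (2.51) p.232, bookkeeping] -/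
theorem sqrt_sum_sq_eq_bl2_of_supp {G' : B6.Geometry} (blk : X → G'.Site) {a' : G'.Site} {ω : X → ℝ} (hω : ∀ x, blk x ≠ a' → ω x = 0) :
    Real.sqrt (∑ x, ω x ^ 2) = bl2 (g := G') blk a' ω := by
  classical
  letI : Fintype G'.Site := G'.fin
  unfold bl2
  congr 1
  rw [← sum_bsq (g := G') blk ω, Finset.sum_eq_single a']
  · intro y _ hy; exact B9SectDL2Decay.bsq_eq_zero_of_loc (g := G') blk hy ω hω
  · intro h; exact absurd (Finset.mem_univ _) h

/-- ★ **THE L² RE-BLOCKING ENGINE, PULL-BACK CARRIER** (dag-n06-w3's `blockBd_comp_reblock` with `S = id`, `r = 1`, `m = 0`, block maps pulled back along `π`): an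
operator `T` on `X → ℝ` with the torus block-L² bound `C·e^{−δd_T}` w.r.t. `blkV1 ∘ π` has, w.r.t. the index-bond block map `bI ∘ π` of a LEVEL- and 1-FAITHFUL
`bI`, the block-L² bound `C·c·e^{(3∕2)δ}·√(e^{δ∕4}c)·e^{−¾δ·d(a,a′)}`. [cite: Balaban1984PropagatorsII, (2.51)–(2.54) pp.232–233, Lemma 2.1 (2.61) p.234, (2.45)–(2.46) p.231; Balaban1985BackgroundPropagators, (3.46) p.398] -/
theorem blockBd_pull_bI_of_blockBd_torus {bI : FBondY i → IBondY i}
    (hlev : ∀ f : FBondY i, lvl i.hN i.D i.hk (bI f) = (blkV1 i.hN i.D f).1.1)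
    (hβ1 : ∀ f : FBondY i, (geomT i.D).dist (β i.hN i.D i.hk (bI f)) (blkV1 i.hN i.D f) ≤ 1)
    {T : Module.End ℝ (X → ℝ)} {C δ : ℝ} (hC : 0 ≤ C) (hδ : 0 ≤ δ)
    (hT : BlockBd (g := geomT i.D) (fun x => blkV1 i.hN i.D (π x)) (fun x => blkV1 i.hN i.D (π x)) T
      (fun y y' => C * Real.exp (-(δ * (geomT i.D).dist y y'))))
    {c : ℝ} (h261 : Ineq261With c (geomT i.D) δ (1 / 4)) (R₀ : ℝ) (H₀ : Prop) [Fintype (geo9K i).Site] :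
    BlockBd (g := toB6 (geo9K i) R₀ H₀) (fun x => bI (π x)) (fun x => bI (π x)) T
      (fun a a' => C * c * Real.exp (3 / 2 * δ) * Real.sqrt (Real.exp (1 / 4 * δ) * c) * Real.exp (-(3 / 4 * δ * (geo9K i).dist a a'))) := by
  -- adapted from `B9BlockL2ReblockEngine.blockBd_comp_reblock` (dag-n06-w3)
  classical
  intro a' ω hω a
  change IBondY i at a' a
  set F : X → ℝ := T ω with hF
  have hc0 : 0 ≤ c := le_trans (Finset.sum_nonneg fun y _ => (Real.exp_pos _).le) (h261 (β i.hN i.D i.hk a))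
  -- the source is spread over the torus blocks within distance 1 of `β a′`
  have hsupp : ∀ x, ω x ≠ 0 → distB i (β i.hN i.D i.hk a') (blkV1 i.hN i.D (π x)) ≤ 1 := by
    intro x hx
    have hxa : bI (π x) = a' := by by_contra h; exact hx (hω x h)
    have := hβ1 (π x)
    rw [hxa] at this
    exact this
  set nS : ℝ := Real.sqrt (∑ x, ω x ^ 2) with hnS
  have hnS0 : 0 ≤ nS := Real.sqrt_nonneg _
  have hnSeq : nS = bl2 (g := toB6 (geo9K i) R₀ H₀) (fun x => bI (π x)) a' ω := sqrt_sum_sq_eq_bl2_of_supp (G' := toB6 (geo9K i) R₀ H₀) _ hω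
  set Kmax : ℝ := C * c * Real.exp (3 / 4 * δ * 1) * Real.exp (3 / 4 * δ) * Real.exp (-(3 / 4 * δ * (geo9K i).dist a a')) with hKmax
  have hKmax0 : 0 ≤ Kmax := by positivity
  have hblk : ∀ B ∈ Finset.univ.filter (fun B : BlkY i => distB i (β i.hN i.D i.hk a) B ≤ 1),
      bsq (g := geomT i.D) (fun x => blkV1 i.hN i.D (π x)) B (blockPiece (g := toB6 (geo9K i) R₀ H₀) (fun x => bI (π x)) a F) ≤ (Kmax * nS) ^ 2 := by
    intro B hB
    have hB1 : distB i (β i.hN i.D i.hk a) B ≤ 1 := (Finset.mem_filter.1 hB).2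
    refine (bsq_blockPiece_pull_bI_le i π hlev R₀ H₀ a F B).trans ?_
    split_ifs with hBl
    · have h1 := bl2_pull_apply_le_of_near i π hC hδ hT h261 (β i.hN i.D i.hk a') ω hsupp B
      have htri : (geo9K i).dist a a' ≤ 1 + distB i B (β i.hN i.D i.hk a') := by
        change distB i (β i.hN i.D i.hk a) (β i.hN i.D i.hk a') ≤ _
        linarith [distB_triangle i (β i.hN i.D i.hk a) B (β i.hN i.D i.hk a')]
      have hexp : Real.exp (-(3 / 4 * δ * distB i B (β i.hN i.D i.hk a'))) ≤
          Real.exp (3 / 4 * δ) * Real.exp (-(3 / 4 * δ * (geo9K i).dist a a')) := by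
        rw [← Real.exp_add]; exact Real.exp_le_exp.2 (by nlinarith [mul_le_mul_of_nonneg_left htri (show (0:ℝ) ≤ 3 / 4 * δ by positivity)])
      have h2 : bl2 (g := geomT i.D) (fun x => blkV1 i.hN i.D (π x)) B F ≤ Kmax * nS := by
        rw [hF]
        refine h1.trans ?_
        rw [hKmax]
        have h0 : 0 ≤ C * c * Real.exp (3 / 4 * δ * 1) := by positivity
        calc C * c * Real.exp (3 / 4 * δ * 1) * Real.exp (-(3 / 4 * δ * distB i B (β i.hN i.D i.hk a'))) * nS
            ≤ C * c * Real.exp (3 / 4 * δ * 1) * (Real.exp (3 / 4 * δ) * Real.exp (-(3 / 4 * δ * (geo9K i).dist a a'))) * nS :=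
              mul_le_mul_of_nonneg_right (mul_le_mul_of_nonneg_left hexp h0) hnS0
          _ = _ := by ring
      calc bsq (g := geomT i.D) (fun x => blkV1 i.hN i.D (π x)) B F = bl2 (g := geomT i.D) (fun x => blkV1 i.hN i.D (π x)) B F ^ 2 := (bl2_sq _ _ _).symm
        _ ≤ (Kmax * nS) ^ 2 := pow_le_pow_left₀ (bl2_nonneg _ _ _) h2 2
    · positivity
  have hcard := card_near_le i hδ h261 (β i.hN i.D i.hk a)
  have hsum : bsq (g := toB6 (geo9K i) R₀ H₀) (fun x => bI (π x)) a F ≤ (Real.exp (1 / 4 * δ) * c) * (Kmax * nS) ^ 2 := by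
    refine (bsq_pull_bI_le_sum_near i π hβ1 R₀ H₀ a F).trans ?_
    refine (Finset.sum_le_sum hblk).trans ?_
    rw [Finset.sum_const, nsmul_eq_mul]
    exact mul_le_mul_of_nonneg_right hcard (sq_nonneg _)
  have hroot : bl2 (g := toB6 (geo9K i) R₀ H₀) (fun x => bI (π x)) a F ≤ Real.sqrt (Real.exp (1 / 4 * δ) * c) * (Kmax * nS) := by
    unfold bl2
    calc Real.sqrt (bsq (g := toB6 (geo9K i) R₀ H₀) (fun x => bI (π x)) a F) ≤ Real.sqrt ((Real.exp (1 / 4 * δ) * c) * (Kmax * nS) ^ 2) := Real.sqrt_le_sqrt hsum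
      _ = Real.sqrt (Real.exp (1 / 4 * δ) * c) * (Kmax * nS) := by
          rw [Real.sqrt_mul (by positivity), Real.sqrt_sq (by positivity)]
  refine hroot.trans (le_of_eq ?_)
  rw [← hnSeq, hKmax, show (3 : ℝ) / 2 * δ = 3 / 4 * δ * 1 + 3 / 4 * δ by ring, Real.exp_add]
  ring

end Reblock

end Literature.MathematicalPhysics.QuantumFieldTheory.Balaban1983to89.B9Eq346GradGpDivCoordsL2

end
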